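import Mathlib.AlgebraicGeometry.EllipticCurve.Affine.Point
import Mathlib.FieldTheory.RatFunc.AsPolynomial
import Literature.IUT.HodgeTheaters.InitialThetaDataAbsoluteGalois
import Literature.AnabelianGeometry.AbsoluteAnabelian.AbsTopIII.Reconstruction
import Literature.AnabelianGeometry.AbsoluteAnabelian.SubpadicExamples
import HarnessLib

/-!
# [IUTchI] Def. 3.1: the named `[AbsTopIII] CurveModel` of an initial Θ-datum —
# `InitialThetaData.nfCurveModel` (the curves `C_F ⊇ X_F`, `C_K ⊇ X_K` with their `Π`'s, Galois groups,
# function fields and NF-function fields)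

S. Mochizuki, *Inter-universal Teichmüller theory I*, §3, Definition 3.1 (a)–(d) (kurims final manuscript,
May 2020, pp. 61–63) [claim: Mochizuki2012, status: disputed]; S. Mochizuki, *Topics in Absolute Anabelian
Geometry III*, §1, Def. 1.7, Thm. 1.9, Rmk. 2.8.3 [MochizukiAbsTopIII2015].  abc-iut cell, GAP B
(`G-L5t9g8-1`, [IUTchI] Ex. 5.4 (iv) ∞κ-compatibility) item GB-07 = `GAP-SIZING-B.md` (sha16
2de24246389ab103) §2 row D7 "the NAMED MODEL at the genuine datum: `def InitialThetaData.nfCurveModel (D) :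
AbsTopIII.CurveModel` (curves `C_F ⊇ C_K ⊇ X_K` from `D.geom : ThetaGeometry` — `extF`, `PiX`, `pe`, `embK`,
`galIso`; `FunctionField`/`NFFunctionField`/`kbarNF` := the `RatFunc` / `F̄` models)", under the chair's
RULINGS #315 (2) / #316 / #330 (2): the reconstruction binder of [IUTchI] Ex. 5.1 (i) / Ex. 5.4 (iv)
("†𝕄^⊛ … by [AbsTopIII] Thm. 1.9") is consumed BY NAME as `(h₁₉ : AbsTopIII.Thm_1_9 D.nfCurveModel)`, an
INSTANCE form at a named model (`CurveModelClosedSurface.lean`: "consumable only AT A NAMED MODEL"), never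
the refuted `∀ M`-form.

WHAT THE MODEL IS (`InitialThetaData.nfCurveModel`, field-by-field status in its docstring): the four GLOBAL
hyperbolic orbicurves `C_F`, `X_F`, `C_K`, `X_K` of Def. 3.1 (b), (d) — index type `NFCurveIndex` — with
* `Π`'s = the INTERFACE `D.geom : ThetaGeometry` (`Π_{C_F} ↠ G` itself; `Π_{X_F}`, `Π_{C_K} = Π_{C_F} ×_{G_F} G_K`,
  `Π_{X_K} = Π_{X_F} ∩ Π_{C_K}` as open subgroups, via the tree's adapter A1 `FundamentalExtension.ofOpenSubgroup`);
* Galois groups GENUINELY identified with Mathlib's `Gal(F^alg/F)`, `Gal(K^alg/K)` (`InitialThetaDataAbsoluteGalois.lean`);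
* REAL base fields `F`, `K`, REAL function fields (`RatFunc`, Mathlib's `WeierstrassCurve.Affine.FunctionField` of
  `E_F`, `E_K`, `E_{F̄}`), REAL flags `IsProper`/`IsScheme`/`genus`/`IsNF…`/`IsCofiniteOpen`;
* NOT RECORDED (empty types, honest label — per RULINGS #330 (2)(a) the "local / NF-point interface fields" are the
  second half of row D7 = item GB-13): cusps, closed points and their decomposition groups.  The closed-point slots
  are exposed as a Type-valued hypothesis record `D.NFPointData` with the general constructor
  `D.nfCurveModelOfPoints N` (`nfCurveModel := nfCurveModelOfPoints NFPointData.empty`), and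
  `thm_1_9_nfCurveModel_of_points : Thm_1_9 (D.nfCurveModelOfPoints N) → Thm_1_9 D.nfCurveModel` is PROVED in
  the companion file (truncate the algorithm's point output): at `nfCurveModel` clause (a) of Thm. 1.9 reads
  "`nfPointDecomp = ∅`", a strictly WEAKER binder than at any points-enriched model — nothing is smuggled in;
* NOT INDEXED: `C_{F_mod}` (Def. 3.1 (b) "`F_mod` … field of moduli"; `Π_{C_{F_mod}} ⊋ Π_{C_F}` is not carried by
  `ThetaGeometry` — GAP-SIZING-B R5), `X̲_K`, `C̲_K`, `X→_K`, `C→_K` (their `Π`'s ARE in `ThetaGeometry`, but their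
  function fields depend on the choice of `C̲_K`, i.e. of a rank-one quotient of `E[l]`, which the datum records only
  through the interface subgroup `Π_{C̲_K}`), and the LOCAL curves `(−)_v̲` (tree: `D.PiLoc`,
  `FundamentalExtension.pullback`; second half of D7).
Companion `InitialThetaDataCurveModelLaws.lean` (same item): `isThm19Input_nfCurveModel` (all four curves are
inputs of Thm. 1.9: strictly Belyi type FILLED BY PRINT, [AbsTopIII] Rmk. 2.8.3 with Def. 3.1 (d) "`K`-core";
sub-`p`-adic REAL, `IsSubpadic.of_isNF`), `kbarNF_nfCurveModel_eq_top` (`k̄_NF = k̄` over a number field — the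
reason the NF-predicates are `True`), `thm_1_9_nfCurveModel_of_points`, and the structure morphisms
`X_F → C_F`, `C_K → C_F`, `X_K → X_F`, `X_K → C_K` (open injective; `C_K → C_F`, `X_K → X_F` base changes).

UNIVERSE: `CurveModel.{u}` puts `base U`, `FunctionField U` and `(ext U).gal ≅ absoluteGaloisGrp (base U)` in
ONE universe, so the model is stated for `F K F̄ : Type u` (the stub of record is polymorphic; specialise).
HONEST LABEL: a MODEL of the interface at the genuine datum — the `Π`'s remain interface data (étale `π₁` of
curves is not constructed in the tree, plan/FOUNDATIONS.md row 12); nothing here asserts [AbsTopIII] Thm. 1.9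
or any reconstruction statement at this model; typed ≠ proved; nothing bears on the disputed [IUTchIII]
Cor. 3.12, no side is taken; no `instance`, no notation.
-/

noncomputable section

namespace Literature.IUT.HodgeTheaters

open CategoryTheory Topology
open Literature.AnabelianGeometry.AbsoluteAnabelian
open Literature.AnabelianGeometry.AbsoluteAnabelian.AbsTopIII

universe u v

namespace InitialThetaData

/-! ### The index of the four global curves and their REAL invariants -/

/-- Index of the four GLOBAL hyperbolic orbicurves of an initial Θ-datum recorded by the interface
`ThetaGeometry` (Def. 3.1 (b), (d)): `C_F` ("`C_F := X_F // {±1}`"), `X_F` ("a once-punctured elliptic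
curve"), `C_K := C_F ×_F K`, `X_K := X_F ×_F K`.  NOT indexed (see the module docstring): `C_{F_mod}`,
`X̲_K`, `C̲_K`, `X→_K`, `C→_K`, the local curves `(−)_v̲`.  (No `deriving` clause: no instance is declared.)
[claim: Mochizuki2012, status: disputed] -/
inductive NFCurveIndex : Type
  /-- `C_F = X_F // {±1}` over `F` (Def. 3.1 (b)) -/
  | CF
  /-- `X_F = E_F ∖ {O}` over `F` (Def. 3.1 (b)) -/
  | XF
  /-- `C_K = C_F ×_F K` over `K` (Def. 3.1 (d)) -/
  | CK
  /-- `X_K = X_F ×_F K` over `K` (Def. 3.1 (d)) -/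
  | XK

namespace NFCurveIndex

/-- `X_F`, `X_K` are scheme-like curves; `C_F`, `C_K` are orbicurves (stacky quotients by `±1`)
(Def. 3.1 (b): "`C_F` … hyperbolic orbicurve"). [claim: Mochizuki2012, status: disputed] -/
def IsScheme : NFCurveIndex → Prop
  | CF => False
  | XF => True
  | CK => False
  | XK => True

/-- Genus of the (coarse) smooth compactification: `1` for `X_F`, `X_K` (the elliptic curve `E_F`), `0`
for `C_F`, `C_K` (coarse space `E_F/{±1} ≅ ℙ¹` via `x`). [claim: Mochizuki2012, status: disputed] -/
def genus : NFCurveIndex → ℕ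
  | CF => 0
  | XF => 1
  | CK => 0
  | XK => 1


end NFCurveIndex

/-! ### No cusps recorded -/

/-- The EMPTY cuspidal data on an extension (no cusp recorded: index type `PEmpty`).  Used where the
interface `ThetaGeometry` carries no cuspidal decomposition groups (honest label: "not recorded", NOT
"the curve has no cusps"). [claim: Mochizuki2012, status: disputed] -/
def noCusps (X : FundamentalExtension.{v}) : X.CuspidalData where
  Cusp := PEmpty
  Dcusp := fun x => x.elim
  Icusp := fun x => x.elim
  Icusp_eq := fun x => x.elim
  isClosed_Dcusp := fun x => x.elim
  eq_of_conj := fun x => x.elim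

/-! ### The model -/

section Model

variable {F K Fbar : Type u} [Field F] [NumberField F] [Field K] [NumberField K] [Algebra F K]
  [Field Fbar] [Algebra F Fbar] [Algebra K Fbar] {E : WeierstrassCurve F} [E.IsElliptic] {l : ℕ}
  {Pb : BadPlacePredicates K} (D : InitialThetaData F K Fbar E l Pb)

/-- The arithmetic fundamental extensions of the four global curves, FROM THE INTERFACE `D.geom`:
`Π_{C_F} ↠ G` is `D.geom.extF` itself; `Π_{X_F}`, `Π_{C_K}`, `Π_{X_K} ⊆ Π_{C_F}` are the open subgroups
`D.geom.PiX`, `D.PiCK = Π_{C_F} ×_{G_F} G_K`, `D.PiXK = Π_{X_F} ∩ Π_{C_K}` (Def. 3.1 (b), (d)) with the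
extension structure of the tree's adapter `FundamentalExtension.ofOpenSubgroup` (Galois group = the image
`aug(−) ⊆ G`, which is `G` resp. `galIso⁻¹(G_K)`: `map_augGF_PiX/PiCK/PiXK`). [claim: Mochizuki2012, status: disputed] -/
def nfCurveExt : NFCurveIndex → FundamentalExtension.{u}
  | .CF => D.geom.extF
  | .XF => D.geom.extF.ofOpenSubgroup D.openPiX
  | .CK => D.geom.extF.ofOpenSubgroup D.openPiCK
  | .XK => D.geom.extF.ofOpenSubgroup D.openPiXK

/-- `Π_{C_F} ↠ G` is the interface extension itself. [claim: Mochizuki2012, status: disputed] -/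
@[simp] theorem nfCurveExt_CF : D.nfCurveExt .CF = D.geom.extF := rfl

/-- `Π_{X_F}`. [claim: Mochizuki2012, status: disputed] -/
@[simp] theorem nfCurveExt_XF : D.nfCurveExt .XF = D.geom.extF.ofOpenSubgroup D.openPiX := rfl

/-- `Π_{C_K}`. [claim: Mochizuki2012, status: disputed] -/
@[simp] theorem nfCurveExt_CK : D.nfCurveExt .CK = D.geom.extF.ofOpenSubgroup D.openPiCK := rfl

/-- `Π_{X_K}`. [claim: Mochizuki2012, status: disputed] -/
@[simp] theorem nfCurveExt_XK : D.nfCurveExt .XK = D.geom.extF.ofOpenSubgroup D.openPiXK := rfl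

/-- CLOSED-POINT DATA for the four global curves — the slots of `CurveModel` that the datum does NOT
determine (decomposition groups of closed points in the interface `Π`'s): a Type-valued HYPOTHESIS record,
to be supplied BY NAME (GAP B item GB-13, the "local / NF-point interface fields" half of row D7), never an
instance.  `nfCurveModelOfPoints` builds the model with these slots filled; `nfCurveModel` uses `empty`.
[claim: Mochizuki2012, status: disputed] -/
structure NFPointData : Type (u + 1) where
  /-- the closed points of the curve `i` -/
  Point : NFCurveIndex → Type u
  /-- a decomposition group in `Π` of each closed point ([AbsTopIII] Cor. 1.10 (e), Thm. 1.9 (a)) -/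
  decomp : ∀ i, Point i → Subgroup (D.nfCurveExt i).arith
  /-- the NF-points ([AbsTopIII] Def. 1.7 (ii); over a number field: all of them) -/
  IsNFPoint : ∀ i, Point i → Prop

/-- NO closed points recorded (`Point i := PEmpty`). [claim: Mochizuki2012, status: disputed] -/
def NFPointData.empty : D.NFPointData where
  Point := fun _ => PEmpty
  decomp := fun _ x => x.elim
  IsNFPoint := fun _ x => x.elim

/-- **The named `[AbsTopIII] CurveModel` at a genuine initial Θ-datum, with closed-point slots `N`**
(`GAP-SIZING-B.md` row D7).  Curves: `ULift NFCurveIndex` = `{C_F, X_F, C_K, X_K}` (Def. 3.1 (b), (d)).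
Field by field (REAL = a genuine Mathlib/tree object of the datum; INTERFACE = from `D.geom : ThetaGeometry`
or from `N`; NOT RECORDED = empty):
* `base` = `F`, `F`, `K`, `K` (REAL); `ext` = `nfCurveExt` (INTERFACE `Π`'s); `galIso` = `galIsoCF/XF/CK/XK`
  (`InitialThetaDataAbsoluteGalois.lean`: GENUINE transports of `D.geom.galIso` to Mathlib's `Gal(F^alg/F)`, `Gal(K^alg/K)`);
* `cusps` = `noCusps` — NOT RECORDED (`ThetaGeometry` carries no cuspidal decomposition groups in `Π_{C_F}`;
  the cusps of `D.geom.pe` lack the finiteness/closedness laws of `CuspidalData`; neither `Thm_1_9` nor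
  `Cor_1_10_*` reads `cusps`);
* `IsProper := False` (all four are affine), `IsScheme` (`X`'s yes, `C`'s no), `genus` = `0, 1, 0, 1` (REAL
  invariants of the compactifications; coarse for the orbicurves);
* `FunctionField` = `RatFunc F`, `E.toAffine.FunctionField`, `RatFunc K`, `(E.baseChange K).toAffine.FunctionField`
  (REAL: `K_C = K_X^{⟨±1⟩} = k(x)`; `K_X =` Mathlib's function field of the Weierstrass curve, the fraction field
  of the coordinate ring of the affine curve `E ∖ {O} = X`); `NFFunctionField` = `RatFunc F̄`,
  `(E.baseChange F̄).toAffine.FunctionField` (REAL: [AbsTopIII] Thm. 1.9 (d) `K_{Z_NF}` with `k̄ = F̄ = k̄_NF`, the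
  datum's algebraic closure of `F` and of `K`, Def. 3.1 (a), (c));
* `Point`, `decomp`, `IsNFPoint` = the slots `N` (INTERFACE when supplied; EMPTY in `nfCurveModel`);
* `IsNFCurve := True`, `IsNFRational := True`, `IsNFConstant := True` (REAL: `k̄_NF = k̄` over a number field,
  `kbarNF_nfCurveModelOfPoints_eq_top`);
* `IsStrictlyBelyiType := True` — FILLED BY PRINT: [AbsTopIII] Rmk. 2.8.3 "any elliptically admissible
  hyperbolic orbicurve defined over a number field is of strictly Belyi type" with Def. 3.1 (d) "`C_K` is a
  `K`-core of `X_K`" (the tree has no contentful predicate; FACT-LIST row F-0058 reading) — so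
  `IsThm19Input` holds at all four curves (`isThm19Input_nfCurveModelOfPoints`; sub-`p`-adicity is REAL);
* `IsCofiniteOpen := False`, `res` vacuous (none of the four is a cofinite open of another).
Universe: `F K F̄ : Type u` (one universe, forced by `CurveModel.{u}`).  HONEST LABEL: a MODEL of the
interface at the genuine datum; the `Π`'s stay interface data (étale `π₁` is not constructed in the tree);
nothing here asserts [AbsTopIII] Thm. 1.9 at this model; no side taken on [IUTchIII] Cor. 3.12.
[claim: Mochizuki2012, status: disputed] -/
def nfCurveModelOfPoints (N : D.NFPointData) : CurveModel.{u} where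
  Curve := ULift.{u + 1} NFCurveIndex
  base U := match U with
    | ⟨.CF⟩ => F
    | ⟨.XF⟩ => F
    | ⟨.CK⟩ => K
    | ⟨.XK⟩ => K
  instField U := match U with
    | ⟨.CF⟩ => (inferInstance : Field F)
    | ⟨.XF⟩ => (inferInstance : Field F)
    | ⟨.CK⟩ => (inferInstance : Field K)
    | ⟨.XK⟩ => (inferInstance : Field K)
  instCharZero U := match U with
    | ⟨.CF⟩ => (inferInstance : CharZero F)
    | ⟨.XF⟩ => (inferInstance : CharZero F)
    | ⟨.CK⟩ => (inferInstance : CharZero K)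
    | ⟨.XK⟩ => (inferInstance : CharZero K)
  ext U := D.nfCurveExt U.down
  galIso U := match U with
    | ⟨.CF⟩ => D.galIsoCF
    | ⟨.XF⟩ => D.galIsoXF
    | ⟨.CK⟩ => D.galIsoCK
    | ⟨.XK⟩ => D.galIsoXK
  cusps U := noCusps (D.nfCurveExt U.down)
  IsProper _ := False
  IsScheme U := U.down.IsScheme
  genus U := U.down.genus
  FunctionField U := match U with
    | ⟨.CF⟩ => RatFunc F
    | ⟨.XF⟩ => E.toAffine.FunctionField
    | ⟨.CK⟩ => RatFunc K
    | ⟨.XK⟩ => (E.baseChange K).toAffine.FunctionField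
  instFunctionField U := match U with
    | ⟨.CF⟩ => (inferInstance : Field (RatFunc F))
    | ⟨.XF⟩ => (inferInstance : Field E.toAffine.FunctionField)
    | ⟨.CK⟩ => (inferInstance : Field (RatFunc K))
    | ⟨.XK⟩ => (inferInstance : Field (E.baseChange K).toAffine.FunctionField)
  instAlgebra U := match U with
    | ⟨.CF⟩ => (inferInstance : Algebra F (RatFunc F))
    | ⟨.XF⟩ => (inferInstance : Algebra F E.toAffine.FunctionField)
    | ⟨.CK⟩ => (inferInstance : Algebra K (RatFunc K))
    | ⟨.XK⟩ => (inferInstance : Algebra K (E.baseChange K).toAffine.FunctionField)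
  Point U := N.Point U.down
  decomp U := N.decomp U.down
  IsNFCurve _ := True
  IsNFPoint U := N.IsNFPoint U.down
  IsNFRational _ _ := True
  IsNFConstant _ _ := True
  NFFunctionField U := match U with
    | ⟨.CF⟩ => RatFunc Fbar
    | ⟨.XF⟩ => (E.baseChange Fbar).toAffine.FunctionField
    | ⟨.CK⟩ => RatFunc Fbar
    | ⟨.XK⟩ => (E.baseChange Fbar).toAffine.FunctionField
  instNFFunctionField U := match U with
    | ⟨.CF⟩ => (inferInstance : Field (RatFunc Fbar))
    | ⟨.XF⟩ => (inferInstance : Field (E.baseChange Fbar).toAffine.FunctionField)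
    | ⟨.CK⟩ => (inferInstance : Field (RatFunc Fbar))
    | ⟨.XK⟩ => (inferInstance : Field (E.baseChange Fbar).toAffine.FunctionField)
  IsStrictlyBelyiType _ := True
  IsCofiniteOpen _ _ := False
  res h := h.elim

/-- **`InitialThetaData.nfCurveModel` — the named `[AbsTopIII] CurveModel` at a genuine initial Θ-datum**
(`GAP-SIZING-B.md` row D7; the model the instance binder `(h₁₉ : Thm_1_9 D.nfCurveModel)` of [IUTchI]
Ex. 5.1 (i) / Ex. 5.4 (iv) is STATED AT): `nfCurveModelOfPoints` with NO closed points recorded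
(`NFPointData.empty`: `Point := PEmpty`), so that clause (a) of `Thm_1_9 D.nfCurveModel` reads
"`nfPointDecomp = ∅`" — a strictly WEAKER binder than at any points-enriched model
(`thm_1_9_nfCurveModel_of_points`: implied by truncation, nothing smuggled); clauses (d)(e) are the REAL
comparisons `constField ≃+* k̄_NF`, `functionField ≃+* F̄(x)` / `F̄(E)`.  See `nfCurveModelOfPoints` for the
field-by-field status (REAL / INTERFACE / NOT RECORDED) and the honest label. [claim: Mochizuki2012, status: disputed] -/
def nfCurveModel : CurveModel.{u} := D.nfCurveModelOfPoints (NFPointData.empty D)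

/-- The curve of the model with points `N` indexed by `i`. [claim: Mochizuki2012, status: disputed] -/
abbrev nfCurveOfPoints (N : D.NFPointData) (i : NFCurveIndex) : (D.nfCurveModelOfPoints N).Curve := ULift.up i

/-- The curve of `nfCurveModel` indexed by `i`. [claim: Mochizuki2012, status: disputed] -/
abbrev nfCurve (i : NFCurveIndex) : D.nfCurveModel.Curve := ULift.up i

/-! ### Unfolding lemmas (all `rfl`) -/

section Unfold

variable (N : D.NFPointData)

/-- `ext` is `nfCurveExt`. [claim: Mochizuki2012, status: disputed] -/
@[simp] theorem nfCurveModelOfPoints_ext (U : (D.nfCurveModelOfPoints N).Curve) :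
    (D.nfCurveModelOfPoints N).ext U = D.nfCurveExt U.down := rfl

/-- `Point` is `N.Point`. [claim: Mochizuki2012, status: disputed] -/
@[simp] theorem nfCurveModelOfPoints_point (U : (D.nfCurveModelOfPoints N).Curve) :
    (D.nfCurveModelOfPoints N).Point U = N.Point U.down := rfl

/-- `nfCurveModel` is `nfCurveModelOfPoints empty`. [claim: Mochizuki2012, status: disputed] -/
theorem nfCurveModel_eq : D.nfCurveModel = D.nfCurveModelOfPoints (NFPointData.empty D) := rfl

/-- `Π_{C_F} ↠ G` of the model IS the interface extension `D.geom.extF`. [claim: Mochizuki2012, status: disputed] -/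
theorem nfCurveModel_ext_CF : D.nfCurveModel.ext (D.nfCurve .CF) = D.geom.extF := rfl

/-- `Π_{X_F}` of the model. [claim: Mochizuki2012, status: disputed] -/
theorem nfCurveModel_ext_XF : D.nfCurveModel.ext (D.nfCurve .XF) = D.geom.extF.ofOpenSubgroup D.openPiX := rfl

/-- `Π_{C_K}` of the model. [claim: Mochizuki2012, status: disputed] -/
theorem nfCurveModel_ext_CK : D.nfCurveModel.ext (D.nfCurve .CK) = D.geom.extF.ofOpenSubgroup D.openPiCK := rfl

/-- `Π_{X_K}` of the model. [claim: Mochizuki2012, status: disputed] -/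
theorem nfCurveModel_ext_XK : D.nfCurveModel.ext (D.nfCurve .XK) = D.geom.extF.ofOpenSubgroup D.openPiXK := rfl

/-- Base field of `C_F`: `F`. [claim: Mochizuki2012, status: disputed] -/
theorem nfCurveModel_base_CF : D.nfCurveModel.base (D.nfCurve .CF) = F := rfl

/-- Base field of `X_F`: `F`. [claim: Mochizuki2012, status: disputed] -/
theorem nfCurveModel_base_XF : D.nfCurveModel.base (D.nfCurve .XF) = F := rfl

/-- Base field of `C_K`: `K`. [claim: Mochizuki2012, status: disputed] -/
theorem nfCurveModel_base_CK : D.nfCurveModel.base (D.nfCurve .CK) = K := rfl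

/-- Base field of `X_K`: `K`. [claim: Mochizuki2012, status: disputed] -/
theorem nfCurveModel_base_XK : D.nfCurveModel.base (D.nfCurve .XK) = K := rfl

/-- `galIso` at `C_F` is `galIsoCF`. [claim: Mochizuki2012, status: disputed] -/
theorem nfCurveModel_galIso_CF : D.nfCurveModel.galIso (D.nfCurve .CF) = D.galIsoCF := rfl

/-- `galIso` at `C_K` is `galIsoCK`. [claim: Mochizuki2012, status: disputed] -/
theorem nfCurveModel_galIso_CK : D.nfCurveModel.galIso (D.nfCurve .CK) = D.galIsoCK := rfl

/-- `K_{C_F} = F(x)`. [claim: Mochizuki2012, status: disputed] -/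
theorem nfCurveModel_functionField_CF : D.nfCurveModel.FunctionField (D.nfCurve .CF) = RatFunc F := rfl

/-- `K_{X_F} = F(E)`, Mathlib's function field of the Weierstrass curve `E`. [claim: Mochizuki2012, status: disputed] -/
theorem nfCurveModel_functionField_XF :
    D.nfCurveModel.FunctionField (D.nfCurve .XF) = E.toAffine.FunctionField := rfl

/-- `K_{C_K} = K(x)`. [claim: Mochizuki2012, status: disputed] -/
theorem nfCurveModel_functionField_CK : D.nfCurveModel.FunctionField (D.nfCurve .CK) = RatFunc K := rfl

/-- `K_{X_K} = K(E_K)`. [claim: Mochizuki2012, status: disputed] -/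
theorem nfCurveModel_functionField_XK :
    D.nfCurveModel.FunctionField (D.nfCurve .XK) = (E.baseChange K).toAffine.FunctionField := rfl

/-- `K_{C_F,NF} = F̄(x)`. [claim: Mochizuki2012, status: disputed] -/
theorem nfCurveModel_nfFunctionField_CF : D.nfCurveModel.NFFunctionField (D.nfCurve .CF) = RatFunc Fbar := rfl

/-- `K_{X_F,NF} = F̄(E)`. [claim: Mochizuki2012, status: disputed] -/
theorem nfCurveModel_nfFunctionField_XF :
    D.nfCurveModel.NFFunctionField (D.nfCurve .XF) = (E.baseChange Fbar).toAffine.FunctionField := rfl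

/-- `K_{C_K,NF} = F̄(x)`. [claim: Mochizuki2012, status: disputed] -/
theorem nfCurveModel_nfFunctionField_CK : D.nfCurveModel.NFFunctionField (D.nfCurve .CK) = RatFunc Fbar := rfl

/-- `K_{X_K,NF} = F̄(E)`. [claim: Mochizuki2012, status: disputed] -/
theorem nfCurveModel_nfFunctionField_XK :
    D.nfCurveModel.NFFunctionField (D.nfCurve .XK) = (E.baseChange Fbar).toAffine.FunctionField := rfl

/-- No closed points are recorded in `nfCurveModel`: `Point U` is empty. [claim: Mochizuki2012, status: disputed] -/
theorem isEmpty_point (U : D.nfCurveModel.Curve) : IsEmpty (D.nfCurveModel.Point U) :=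
  inferInstanceAs (IsEmpty PEmpty)

/-- No cusps are recorded: `(cusps U).Cusp` is empty. [claim: Mochizuki2012, status: disputed] -/
theorem isEmpty_cusp (U : (D.nfCurveModelOfPoints N).Curve) : IsEmpty ((D.nfCurveModelOfPoints N).cusps U).Cusp :=
  inferInstanceAs (IsEmpty PEmpty)

end Unfold


end Model

end InitialThetaData
end Literature.IUT.HodgeTheaters
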